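import Mathlib
import Literature.Analysis.FunctionSpaces.SobolevBallScaling
import Literature.Analysis.FluidPDE.CKNInterpolationEstimate
import Summits.NavierStokesRegularity.NavierStokesRegularity.Theorems.EulerZoomLiouvillePowerGaugeEulerLiouvilleSelfSimilarPastProfileEquations
import Summits.NavierStokesRegularity.NavierStokesRegularity.Theorems.EulerZoomLiouvillePowerGaugeEulerLiouvilleSelfSimilarBernoulliSqueezeSobolev
import HarnessLib

/-!
# THE FAST SET OF A WEAK CLASS PROFILE IS SOBOLEV-THIN (rate `3 + 3ρ`, no regularity)
# (crux `EulerZoomLiouville.PowerGaugeEulerLiouville` = stmt-NavierStokesRegularity-19832, line `birth`, open stub `stub_selfSimilarWeakRest`)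

Width seat `ns-ezl-w1` (g6) under the crux LEAD, cell ns-regularity-ideate.  TOOL for the genuinely weak exactly-self-similar stratum.
The `C²`-needle files prove (`Loc.volume_fastSet_inter_shell_le_sobolev`, `…SelfSimilarBernoulliSqueezeSobolev`, hypothesis `ContDiff ℝ 1 V`) that the
FAST SET `{a‖y‖ ≤ ‖V y‖}` of a class-rate profile is thin on dyadic shells with the SOBOLEV rate `m = 3 + 3ρ`:
`vol({a‖y‖ ≤ ‖V y‖} ∩ {L ≤ ‖y‖ ≤ 2L}) ≤ K L^{−3−3ρ}` — the `E`-gauge `∫_{B_L}|∇V|² ≲ L^{1−ρ}` through Gagliardo–Nirenberg–Sobolev and Chebyshev in `L⁶`.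
HERE the same rate is obtained WITHOUT ANY REGULARITY, for a profile `V` with a whole-space WEAK gradient `G`, from the large-scale growth bounds
`∫_{B_L}‖V‖² ≤ c_A L^{1−2ρ}`, `∫_{B_L}|G|²_F ≤ c_E L^{1−ρ}` (`L ≥ L₀ ≥ 1`) that every weak class member hands to its profile
(`Past.profileData_of_past`), via the SCALE-INVARIANT Sobolev inequality on balls of the tree
(`Literature.Analysis.FunctionSpaces.exists_eLpNorm_le_ball`: `‖f‖_{L⁶(B_r)} ≤ C(r⁻¹‖f‖_{L²(B_r)} + ‖Df‖_{L²(B_r)})`):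
`‖V‖_{L⁶(B_{3L})} ≲ L^{(1−ρ)/2}`, and Chebyshev in `L⁶` on `{‖V‖ ≥ aL} ⊇ fast ∩ shell`.

* `WeakThin.eLpNorm_six_ball_le` — `‖V‖_{L⁶(B_R)} ≤ C(√c_A + √c_E) R^{(1−ρ)/2}` for `R ≥ L₀` (`R ≥ 1`, `ρ ≥ −2`);
* **`WeakThin.volume_fastSet_inter_shell_le`** — the weak-class Sobolev thinness of the fast set (profile level);
* **`WeakThin.volume_fastSet_inter_shell_le_of_past`** — MEMBER LEVEL: crux hypotheses verbatim + exact self-similarity about `(T, x₀)` on a past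
  sub-slab (`0 < ρ ≤ ½`) ⇒ for every `a > 0` some `K ≥ 0`, `L₀` with the displayed bound for `L ≥ L₀`.

WHAT THIS IS NOT: not NS, not E, not the stub — a weak-class PORTRAIT TOOL (`--supports` stmt-19832): the (C2) volume race `3γ < c₁(3+3ρ)` of the needle files
is now available on `stub_selfSimilarWeakRest` as far as the fast set is concerned. [folklore; Gagliardo–Nirenberg–Sobolev + Chebyshev]
-/

noncomputable section

set_option linter.dupNamespace false

open MeasureTheory Set Filter Topology Metric Function TopologicalSpace
open scoped ENNReal NNReal RealInnerProductSpace

namespace Summit.NavierStokesRegularity.NavierStokesRegularity.Theorems.PowerGaugeEulerLiouville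

open Literature.Analysis Literature.Analysis.FunctionSpaces Literature.Analysis.FluidPDE

namespace WeakThin

variable {V : EuclideanSpace ℝ (Fin 3) → EuclideanSpace ℝ (Fin 3)}
  {G : EuclideanSpace ℝ (Fin 3) → EuclideanSpace ℝ (Fin 3) →L[ℝ] EuclideanSpace ℝ (Fin 3)}

/-- **`‖V‖_{L⁶(B_R)} ≲ R^{(1−ρ)/2}` in the weak class.**  `V` a.e.-strongly measurable with whole-space weak gradient `G`; at the radius `R ≥ 1`:
`∫_{B_R}‖V‖² ≤ c_A R^{1−2ρ}`, `∫_{B_R}|G|²_F ≤ c_E R^{1−ρ}` (`ρ ≥ −2`).  Then `‖V‖_{L⁶(B_R)} ≤ C(√c_A + √c_E) R^{(1−ρ)/2}` with the scale-invariant Sobolev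
constant `C` of `exists_eLpNorm_le_ball`. [folklore] -/
theorem eLpNorm_six_ball_le {ρ : ℝ} (hρ : -2 ≤ ρ) (hVm : AEStronglyMeasurable V volume)
    (hVG : HasWeakFDerivOn (⊤ : Opens (EuclideanSpace ℝ (Fin 3))) volume V G)
    {C : ℝ≥0}
    (hC : ∀ (x₀ : EuclideanSpace ℝ (Fin 3)) (r : ℝ), 0 < r →
      ∀ (f : EuclideanSpace ℝ (Fin 3) → EuclideanSpace ℝ (Fin 3)) (g : EuclideanSpace ℝ (Fin 3) → EuclideanSpace ℝ (Fin 3) →L[ℝ] EuclideanSpace ℝ (Fin 3)),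
      MemSobolevDomain 1 ((2 : ℝ≥0) : ℝ≥0∞) (⟨ball x₀ r, isOpen_ball⟩ : Opens (EuclideanSpace ℝ (Fin 3))) volume f →
      HasWeakFDerivOn (⟨ball x₀ r, isOpen_ball⟩ : Opens (EuclideanSpace ℝ (Fin 3))) volume f g →
      eLpNorm f ((6 : ℝ≥0) : ℝ≥0∞) (volume.restrict (ball x₀ r)) ≤
        C * ((ENNReal.ofReal r)⁻¹ * eLpNorm f ((2 : ℝ≥0) : ℝ≥0∞) (volume.restrict (ball x₀ r)) +
          eLpNorm g ((2 : ℝ≥0) : ℝ≥0∞) (volume.restrict (ball x₀ r))))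
    {cA cE R : ℝ} (hcA : 0 ≤ cA) (hcE : 0 ≤ cE) (hR : 1 ≤ R)
    (hA : ∫⁻ y in ball (0 : EuclideanSpace ℝ (Fin 3)) R, ‖V y‖ₑ ^ 2 ≤ ENNReal.ofReal (cA * R ^ (1 - 2 * ρ)))
    (hE : ∫⁻ y in ball (0 : EuclideanSpace ℝ (Fin 3)) R, ENNReal.ofReal (frobeniusNormSq (G y)) ≤ ENNReal.ofReal (cE * R ^ (1 - ρ))) :
    eLpNorm V 6 (volume.restrict (ball (0 : EuclideanSpace ℝ (Fin 3)) R)) ≤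
      ENNReal.ofReal ((C : ℝ) * (Real.sqrt cA + Real.sqrt cE) * R ^ ((1 - ρ) / 2)) := by
  have hR0 : 0 < R := lt_of_lt_of_le one_pos hR
  set μR := (volume : Measure (EuclideanSpace ℝ (Fin 3))).restrict (ball (0 : EuclideanSpace ℝ (Fin 3)) R) with hμR
  set U : Opens (EuclideanSpace ℝ (Fin 3)) := ⟨ball (0 : EuclideanSpace ℝ (Fin 3)) R, isOpen_ball⟩ with hUdef
  have hGl : LocallyIntegrable G volume := locallyIntegrableOn_univ.1 (by
    simpa only [Opens.coe_top] using hVG.locallyIntegrableOn_deriv)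
  have hGm : AEStronglyMeasurable G volume := hGl.aestronglyMeasurable
  -- `L²` data on the ball
  have e2 : ((2 : ℝ≥0) : ℝ≥0∞) = 2 := by norm_num
  have e6 : ((6 : ℝ≥0) : ℝ≥0∞) = 6 := by norm_num
  have hV2eq : eLpNorm V 2 μR = (∫⁻ y in ball (0 : EuclideanSpace ℝ (Fin 3)) R, ‖V y‖ₑ ^ 2) ^ (1 / 2 : ℝ) := by
    rw [eLpNorm_eq_lintegral_rpow_enorm_toReal two_ne_zero ENNReal.ofNat_ne_top, ENNReal.toReal_ofNat]
    congr 1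
    refine lintegral_congr fun y => ?_
    exact ENNReal.rpow_two _
  have hV2le : eLpNorm V 2 μR ≤ ENNReal.ofReal (Real.sqrt (cA * R ^ (1 - 2 * ρ))) := by
    rw [hV2eq, Real.sqrt_eq_rpow, ← ENNReal.ofReal_rpow_of_nonneg (by positivity) (by norm_num)]
    exact ENNReal.rpow_le_rpow hA (by norm_num)
  have hG2le : eLpNorm G 2 μR ≤ ENNReal.ofReal (Real.sqrt (cE * R ^ (1 - ρ))) := by
    refine (eLpNorm_two_le_lintegral_frobeniusNormSq_rpow μR G).trans ?_
    rw [Real.sqrt_eq_rpow, ← ENNReal.ofReal_rpow_of_nonneg (by positivity) (by norm_num)]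
    exact ENNReal.rpow_le_rpow hE (by norm_num)
  have hV2 : MemLp V 2 μR := ⟨hVm.restrict, lt_of_le_of_lt hV2le ENNReal.ofReal_lt_top⟩
  have hG2 : MemLp G 2 μR := ⟨hGm.restrict, lt_of_le_of_lt hG2le ENNReal.ofReal_lt_top⟩
  have hVGU : HasWeakFDerivOn U volume V G := HasWeakFDerivOn.mono_set_holds hVG le_top
  have hSob : MemSobolevDomain 1 ((2 : ℝ≥0) : ℝ≥0∞) U volume V := by
    rw [memSobolevDomain_succ_iff, e2]
    refine ⟨hV2, G, hVGU, fun v => ?_⟩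
    rw [memSobolevDomain_zero_iff]
    exact (ContinuousLinearMap.apply ℝ (EuclideanSpace ℝ (Fin 3)) v).comp_memLp' hG2
  -- the scale-invariant Sobolev inequality
  have hS := hC 0 R hR0 V G hSob hVGU
  rw [e2, e6] at hS
  refine hS.trans ?_
  -- real bookkeeping
  have hsA : Real.sqrt (cA * R ^ (1 - 2 * ρ)) = Real.sqrt cA * R ^ ((1 - 2 * ρ) / 2) := by
    rw [Real.sqrt_mul hcA, Real.sqrt_eq_rpow (R ^ (1 - 2 * ρ)), ← Real.rpow_mul hR0.le]
    ring_nf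
  have hsE : Real.sqrt (cE * R ^ (1 - ρ)) = Real.sqrt cE * R ^ ((1 - ρ) / 2) := by
    rw [Real.sqrt_mul hcE, Real.sqrt_eq_rpow (R ^ (1 - ρ)), ← Real.rpow_mul hR0.le]
    ring_nf
  have hpow : R⁻¹ * R ^ ((1 - 2 * ρ) / 2) ≤ R ^ ((1 - ρ) / 2) := by
    rw [← Real.rpow_neg_one, ← Real.rpow_add hR0]
    exact Real.rpow_le_rpow_of_exponent_le hR (by linarith)
  have hreal : R⁻¹ * Real.sqrt (cA * R ^ (1 - 2 * ρ)) + Real.sqrt (cE * R ^ (1 - ρ)) ≤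
      (Real.sqrt cA + Real.sqrt cE) * R ^ ((1 - ρ) / 2) := by
    rw [hsA, hsE, ← mul_assoc, mul_comm R⁻¹, mul_assoc, add_mul]
    exact add_le_add (mul_le_mul_of_nonneg_left hpow (Real.sqrt_nonneg _)) le_rfl
  calc (C : ℝ≥0∞) * ((ENNReal.ofReal R)⁻¹ * eLpNorm V 2 μR + eLpNorm G 2 μR)
      ≤ (C : ℝ≥0∞) * ((ENNReal.ofReal R)⁻¹ * ENNReal.ofReal (Real.sqrt (cA * R ^ (1 - 2 * ρ))) +
          ENNReal.ofReal (Real.sqrt (cE * R ^ (1 - ρ)))) := by gcongr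
    _ = ENNReal.ofReal ((C : ℝ) * (R⁻¹ * Real.sqrt (cA * R ^ (1 - 2 * ρ)) + Real.sqrt (cE * R ^ (1 - ρ)))) := by
        rw [← ENNReal.ofReal_inv_of_pos hR0, ← ENNReal.ofReal_mul (inv_nonneg.2 hR0.le),
          ← ENNReal.ofReal_add (by positivity) (Real.sqrt_nonneg _), ← ENNReal.ofReal_coe_nnreal,
          ← ENNReal.ofReal_mul (NNReal.coe_nonneg _)]
    _ ≤ ENNReal.ofReal ((C : ℝ) * (Real.sqrt cA + Real.sqrt cE) * R ^ ((1 - ρ) / 2)) := by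
        apply ENNReal.ofReal_le_ofReal
        rw [mul_assoc]
        exact mul_le_mul_of_nonneg_left hreal (NNReal.coe_nonneg _)

/-- **THE FAST SET OF A WEAK CLASS PROFILE IS SOBOLEV-THIN (rate `3+3ρ`).**  `V` a.e.-strongly measurable with whole-space weak gradient `G` and the
LARGE-SCALE growth `∫_{B_L}‖V‖² ≤ c_A L^{1−2ρ}`, `∫_{B_L}|G|²_F ≤ c_E L^{1−ρ}` for `L ≥ L₀` (`L₀ ≥ 1`, `ρ ≥ −2`).  Then for every `a > 0` there is `K ≥ 0` with
`vol({a‖y‖ ≤ ‖V y‖} ∩ {L ≤ ‖y‖ ≤ 2L}) ≤ K L^{−3−3ρ}` for all `L ≥ L₀` — NO regularity (scale-invariant Sobolev on `B(0, 3L)` + Chebyshev in `L⁶`).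
[folklore; Gagliardo–Nirenberg–Sobolev + Chebyshev] -/
theorem volume_fastSet_inter_shell_le {ρ : ℝ} (hρ : -2 ≤ ρ) (hVm : AEStronglyMeasurable V volume)
    (hVG : HasWeakFDerivOn (⊤ : Opens (EuclideanSpace ℝ (Fin 3))) volume V G)
    {cA cE L₀ : ℝ} (hcA : 0 ≤ cA) (hcE : 0 ≤ cE) (hL₀ : 1 ≤ L₀)
    (hA : ∀ L : ℝ, L₀ ≤ L → ∫⁻ y in ball (0 : EuclideanSpace ℝ (Fin 3)) L, ‖V y‖ₑ ^ 2 ≤ ENNReal.ofReal (cA * L ^ (1 - 2 * ρ)))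
    (hE : ∀ L : ℝ, L₀ ≤ L → ∫⁻ y in ball (0 : EuclideanSpace ℝ (Fin 3)) L, ENNReal.ofReal (frobeniusNormSq (G y)) ≤
      ENNReal.ofReal (cE * L ^ (1 - ρ)))
    {a : ℝ} (ha : 0 < a) :
    ∃ K : ℝ, 0 ≤ K ∧ ∀ L : ℝ, L₀ ≤ L →
      volume ({y : EuclideanSpace ℝ (Fin 3) | a * ‖y‖ ≤ ‖V y‖} ∩ {y | L ≤ ‖y‖ ∧ ‖y‖ ≤ 2 * L}) ≤
        ENNReal.ofReal (K * L ^ (-3 - 3 * ρ)) := by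
  have h3 : Module.finrank ℝ (EuclideanSpace ℝ (Fin 3)) = 3 := finrank_euclideanSpace_fin
  obtain ⟨C, hC⟩ := exists_eLpNorm_le_ball (E := EuclideanSpace ℝ (Fin 3)) (F := EuclideanSpace ℝ (Fin 3))
    (p := 2) (p' := 6) (by norm_num) (by rw [h3]; norm_num) (by rw [h3]; norm_num)
  set C' : ℝ := (C : ℝ) * (Real.sqrt cA + Real.sqrt cE) with hC'
  have hC'0 : 0 ≤ C' := by positivity
  set e : ℝ := (1 - ρ) / 2 with hedef
  refine ⟨C' ^ 6 * (3 : ℝ) ^ (e * 6) / a ^ 6, by positivity, fun L hL => ?_⟩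
  have hL1 : 1 ≤ L := le_trans hL₀ hL
  have hL0 : 0 < L := lt_of_lt_of_le one_pos hL1
  set R : ℝ := 3 * L with hRdef
  have hR1 : 1 ≤ R := by rw [hRdef]; linarith
  have hR0 : 0 < R := by positivity
  have hRL₀ : L₀ ≤ R := by rw [hRdef]; linarith [le_trans (le_trans zero_le_one hL₀) hL]
  set μR := (volume : Measure (EuclideanSpace ℝ (Fin 3))).restrict (ball (0 : EuclideanSpace ℝ (Fin 3)) R) with hμR
  -- the `L⁶` bound on `B(0, 3L)`
  have hB : eLpNorm V 6 μR ≤ ENNReal.ofReal (C' * R ^ e) :=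
    eLpNorm_six_ball_le hρ hVm hVG hC hcA hcE hR1 (hA R hRL₀) (hE R hRL₀)
  -- Chebyshev in `L⁶`
  set S : Set (EuclideanSpace ℝ (Fin 3)) := {y | a * ‖y‖ ≤ ‖V y‖} ∩ {y | L ≤ ‖y‖ ∧ ‖y‖ ≤ 2 * L} with hS
  set ε : ℝ≥0∞ := ENNReal.ofReal (a * L) with hεdef
  have haL : 0 < a * L := by positivity
  have hε0 : ε ≠ 0 := (ENNReal.ofReal_pos.2 haL).ne'
  have hεtop : ε ≠ ⊤ := ENNReal.ofReal_ne_top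
  have hSsub : S ⊆ {y | ε ≤ ‖V y‖ₑ} ∩ ball (0 : EuclideanSpace ℝ (Fin 3)) R := by
    intro y hy
    obtain ⟨hyV, hyL, hy2L⟩ := hy
    refine ⟨?_, ?_⟩
    · show ENNReal.ofReal (a * L) ≤ ‖V y‖ₑ
      rw [← ofReal_norm]
      exact ENNReal.ofReal_le_ofReal (le_trans (mul_le_mul_of_nonneg_left hyL ha.le) hyV)
    · rw [mem_ball, dist_zero_right, hRdef]; linarith
  have hcheb := mul_meas_ge_le_pow_eLpNorm' (μ := μR) (p := (6 : ℝ≥0∞)) (by norm_num) ENNReal.ofNat_ne_top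
    hVm.restrict ε
  rw [ENNReal.toReal_ofNat] at hcheb
  have hset : μR {y | ε ≤ ‖V y‖ₑ} = volume ({y | ε ≤ ‖V y‖ₑ} ∩ ball (0 : EuclideanSpace ℝ (Fin 3)) R) := by
    rw [hμR, Measure.restrict_apply' measurableSet_ball]
  have hvol : volume S ≤ eLpNorm V 6 μR ^ (6 : ℝ) / ε ^ (6 : ℝ) := by
    rw [ENNReal.le_div_iff_mul_le (Or.inl (by positivity)) (Or.inl (by simp [hεtop])), mul_comm]
    calc ε ^ (6 : ℝ) * volume S ≤ ε ^ (6 : ℝ) * μR {y | ε ≤ ‖V y‖ₑ} := by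
          rw [hset]; gcongr
      _ ≤ eLpNorm V 6 μR ^ (6 : ℝ) := hcheb
  refine hvol.trans ?_
  -- everything in `ℝ`
  have hpow6 : ∀ x : ℝ≥0∞, x ^ (6 : ℝ) = x ^ 6 := fun x => by
    rw [show (6 : ℝ) = ((6 : ℕ) : ℝ) by norm_num, ENNReal.rpow_natCast]
  rw [hpow6, hpow6, hεdef, ← ENNReal.ofReal_pow haL.le]
  have hC'R : 0 ≤ C' * R ^ e := mul_nonneg hC'0 (Real.rpow_nonneg hR0.le _)
  have hnum : eLpNorm V 6 μR ^ 6 ≤ ENNReal.ofReal ((C' * R ^ e) ^ 6) := by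
    rw [ENNReal.ofReal_pow hC'R]
    exact pow_le_pow_left' hB 6
  calc eLpNorm V 6 μR ^ 6 / ENNReal.ofReal ((a * L) ^ 6)
      ≤ ENNReal.ofReal ((C' * R ^ e) ^ 6) / ENNReal.ofReal ((a * L) ^ 6) := by gcongr
    _ = ENNReal.ofReal ((C' * R ^ e) ^ 6 / (a * L) ^ 6) := (ENNReal.ofReal_div_of_pos (by positivity)).symm
    _ = ENNReal.ofReal (C' ^ 6 * (3 : ℝ) ^ (e * 6) / a ^ 6 * L ^ (-3 - 3 * ρ)) := by
        congr 1
        have h1 : (R ^ e) ^ 6 = (3 : ℝ) ^ (e * 6) * L ^ (e * 6) := by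
          rw [← Real.rpow_natCast (R ^ e) 6, ← Real.rpow_mul hR0.le, hRdef, Real.mul_rpow (by norm_num) hL0.le]
          norm_num
        have h2 : L ^ (e * 6) = L ^ (-3 - 3 * ρ) * L ^ (6 : ℕ) := by
          rw [← Real.rpow_natCast L 6, ← Real.rpow_add hL0]
          congr 1
          rw [hedef]; push_cast; ring
        have hL6 : (L ^ (6 : ℕ)) ≠ 0 := pow_ne_zero 6 hL0.ne'
        have ha6 : a ^ 6 ≠ 0 := pow_ne_zero 6 ha.ne'
        rw [mul_pow, h1, h2]
        field_simp


/-! ## Member level -/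

/-- **THE FAST SET OF A WEAK SELF-SIMILAR CLASS MEMBER'S PROFILE IS SOBOLEV-THIN** (`0 < ρ ≤ ½`; NO regularity of the profile): crux hypotheses
verbatim, exact self-similarity about `(T, x₀)` for `τ < T₁` (`T₁ ≤ 0`, `T₁ ≤ T`) ⇒ for every `a > 0` there are `K ≥ 0` and `L₀` with
`vol({a‖y‖ ≤ ‖V y‖} ∩ {L ≤ ‖y‖ ≤ 2L}) ≤ K L^{−3−3ρ}` for all `L ≥ L₀` (`Past.profileData_of_past` + `volume_fastSet_inter_shell_le`). [folklore] -/
theorem volume_fastSet_inter_shell_le_of_past {ρ : ℝ} (hρ : 0 < ρ) (hρh : ρ ≤ 1 / 2)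
    {T T₁ : ℝ} (hT₁ : T₁ ≤ 0) (hTT₁ : T₁ ≤ T) (x₀ : EuclideanSpace ℝ (Fin 3))
    {u : ℝ → EuclideanSpace ℝ (Fin 3) → EuclideanSpace ℝ (Fin 3)} {p : ℝ → EuclideanSpace ℝ (Fin 3) → ℝ}
    {H : ℝ → EuclideanSpace ℝ (Fin 3) → EuclideanSpace ℝ (Fin 3) →L[ℝ] EuclideanSpace ℝ (Fin 3)} {c : ℝ≥0}
    (hsw : IsSuitableWeakSolutionOn (slab (EuclideanSpace ℝ (Fin 3)) (Iio 0) isOpen_Iio) 0 0 u p)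
    (hH : HasWeakSpatialGradientOn (slab (EuclideanSpace ℝ (Fin 3)) (Iio 0) isOpen_Iio) u H)
    (hgauge : ∀ a : ℝ, 0 < a →
      ENNReal.ofReal (a ^ (2 * ρ)) * cknA a (0 : ℝ × EuclideanSpace ℝ (Fin 3)) u +
          ENNReal.ofReal (a ^ ρ) * cknE a (0 : ℝ × EuclideanSpace ℝ (Fin 3)) H +
        ENNReal.ofReal (a ^ (2 * ρ)) * cknD a (0 : ℝ × EuclideanSpace ℝ (Fin 3)) p ≤ (c : ℝ≥0∞))
    {V : EuclideanSpace ℝ (Fin 3) → EuclideanSpace ℝ (Fin 3)} {P : EuclideanSpace ℝ (Fin 3) → ℝ}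
    (hu : ∀ τ : ℝ, τ < T₁ → u τ = fun x => selfSimilarCollapse (1 / (2 + ρ)) T V τ (x - x₀))
    (hp : ∀ τ : ℝ, τ < T₁ → p τ = fun x => selfSimilarCollapsePressure (1 / (2 + ρ)) T P τ (x - x₀))
    {a : ℝ} (ha : 0 < a) :
    ∃ K L₀ : ℝ, 0 ≤ K ∧ ∀ L : ℝ, L₀ ≤ L →
      volume ({y : EuclideanSpace ℝ (Fin 3) | a * ‖y‖ ≤ ‖V y‖} ∩ {y | L ≤ ‖y‖ ∧ ‖y‖ ≤ 2 * L}) ≤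
        ENNReal.ofReal (K * L ^ (-3 - 3 * ρ)) := by
  have hA' : ∀ a : ℝ, 0 < a → ENNReal.ofReal (a ^ (2 * ρ)) *
      cknA a (0 : ℝ × EuclideanSpace ℝ (Fin 3)) u ≤ (c : ℝ≥0∞) :=
    fun a ha => le_trans (le_trans le_self_add le_self_add) (hgauge a ha)
  have hE' : ∀ a : ℝ, 0 < a → ENNReal.ofReal (a ^ ρ) *
      cknE a (0 : ℝ × EuclideanSpace ℝ (Fin 3)) H ≤ (c : ℝ≥0∞) :=
    fun a ha => le_trans (le_trans le_add_self le_self_add) (hgauge a ha)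
  have hD' : ∀ a : ℝ, 0 < a → ENNReal.ofReal (a ^ (2 * ρ)) *
      cknD a (0 : ℝ × EuclideanSpace ℝ (Fin 3)) p ≤ (c : ℝ≥0∞) :=
    fun a ha => le_trans le_add_self (hgauge a ha)
  obtain ⟨G, hVm, -, -, hVG, -, ⟨CA, hCA, hA⟩, ⟨CE, hCE, hE⟩, -⟩ :=
    Past.profileData_of_past hρ hρh hT₁ hTT₁ x₀ hsw.distributional hH hA' hE' hD' hu hp
  set L₀ : ℝ := max (2 - T₁) 1 with hL₀
  have hL₀1 : 1 ≤ L₀ := le_max_right _ _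
  have hAr : ∀ L : ℝ, L₀ ≤ L → ∫⁻ y in ball (0 : EuclideanSpace ℝ (Fin 3)) L, ‖V y‖ₑ ^ 2 ≤
      ENNReal.ofReal (CA.toReal * L ^ (1 - 2 * ρ)) := fun L hL => by
    rw [ENNReal.ofReal_mul ENNReal.toReal_nonneg, ENNReal.ofReal_toReal hCA]
    exact hA L (le_trans (le_max_left _ _) hL)
  have hEr : ∀ L : ℝ, L₀ ≤ L → ∫⁻ y in ball (0 : EuclideanSpace ℝ (Fin 3)) L, ENNReal.ofReal (frobeniusNormSq (G y)) ≤
      ENNReal.ofReal (CE.toReal * L ^ (1 - ρ)) := fun L hL => by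
    rw [ENNReal.ofReal_mul ENNReal.toReal_nonneg, ENNReal.ofReal_toReal hCE]
    exact hE L (le_trans (le_max_left _ _) hL)
  obtain ⟨K, hK0, hK⟩ := volume_fastSet_inter_shell_le (ρ := ρ) (by linarith) hVm hVG ENNReal.toReal_nonneg
    ENNReal.toReal_nonneg hL₀1 hAr hEr ha
  exact ⟨K, L₀, hK0, hK⟩

/-! ## The far (dyadic-tail) form — appended -/

/-- **Far form of the weak fast-set thinness**: under the hypotheses of `volume_fastSet_inter_shell_le` with `ρ > −1`,
`vol({a‖y‖ ≤ ‖V y‖} ∩ {R ≤ ‖y‖}) ≤ K′ R^{−3−3ρ}` for `R ≥ L₀` (dyadic tail `Loc.volume_inter_far_le_of_shell`). [folklore] -/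
theorem volume_fastSet_inter_far_le {ρ : ℝ} (hρ : -1 < ρ) (hVm : AEStronglyMeasurable V volume)
    (hVG : HasWeakFDerivOn (⊤ : Opens (EuclideanSpace ℝ (Fin 3))) volume V G)
    {cA cE L₀ : ℝ} (hcA : 0 ≤ cA) (hcE : 0 ≤ cE) (hL₀ : 1 ≤ L₀)
    (hA : ∀ L : ℝ, L₀ ≤ L → ∫⁻ y in ball (0 : EuclideanSpace ℝ (Fin 3)) L, ‖V y‖ₑ ^ 2 ≤ ENNReal.ofReal (cA * L ^ (1 - 2 * ρ)))
    (hE : ∀ L : ℝ, L₀ ≤ L → ∫⁻ y in ball (0 : EuclideanSpace ℝ (Fin 3)) L, ENNReal.ofReal (frobeniusNormSq (G y)) ≤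
      ENNReal.ofReal (cE * L ^ (1 - ρ)))
    {a : ℝ} (ha : 0 < a) :
    ∃ K : ℝ, 0 ≤ K ∧ ∀ R : ℝ, L₀ ≤ R →
      volume ({y : EuclideanSpace ℝ (Fin 3) | a * ‖y‖ ≤ ‖V y‖} ∩ {y | R ≤ ‖y‖}) ≤
        ENNReal.ofReal (K * R ^ (-3 - 3 * ρ)) := by
  obtain ⟨K, hK0, hK⟩ := volume_fastSet_inter_shell_le (ρ := ρ) (by linarith) hVm hVG hcA hcE hL₀ hA hE ha
  have hs : -3 - 3 * ρ < 0 := by linarith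
  have h2s : (2 : ℝ) ^ (-3 - 3 * ρ) < 1 := Real.rpow_lt_one_of_one_lt_of_neg one_lt_two hs
  refine ⟨|K| * (1 - (2 : ℝ) ^ (-3 - 3 * ρ))⁻¹, by positivity, fun R hR => ?_⟩
  exact Loc.volume_inter_far_le_of_shell _ (lt_of_lt_of_le one_pos hL₀) hs hK hR

/-- **Far form, member level**: crux hypotheses verbatim + exact self-similarity about `(T, x₀)` on a past sub-slab (`0 < ρ ≤ ½`) ⇒ for every `a > 0`
there are `K ≥ 0`, `L₀` with `vol({a‖y‖ ≤ ‖V y‖} ∩ {R ≤ ‖y‖}) ≤ K R^{−3−3ρ}` for `R ≥ L₀`. [folklore] -/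
theorem volume_fastSet_inter_far_le_of_past {ρ : ℝ} (hρ : 0 < ρ) (hρh : ρ ≤ 1 / 2)
    {T T₁ : ℝ} (hT₁ : T₁ ≤ 0) (hTT₁ : T₁ ≤ T) (x₀ : EuclideanSpace ℝ (Fin 3))
    {u : ℝ → EuclideanSpace ℝ (Fin 3) → EuclideanSpace ℝ (Fin 3)} {p : ℝ → EuclideanSpace ℝ (Fin 3) → ℝ}
    {H : ℝ → EuclideanSpace ℝ (Fin 3) → EuclideanSpace ℝ (Fin 3) →L[ℝ] EuclideanSpace ℝ (Fin 3)} {c : ℝ≥0}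
    (hsw : IsSuitableWeakSolutionOn (slab (EuclideanSpace ℝ (Fin 3)) (Iio 0) isOpen_Iio) 0 0 u p)
    (hH : HasWeakSpatialGradientOn (slab (EuclideanSpace ℝ (Fin 3)) (Iio 0) isOpen_Iio) u H)
    (hgauge : ∀ a : ℝ, 0 < a →
      ENNReal.ofReal (a ^ (2 * ρ)) * cknA a (0 : ℝ × EuclideanSpace ℝ (Fin 3)) u +
          ENNReal.ofReal (a ^ ρ) * cknE a (0 : ℝ × EuclideanSpace ℝ (Fin 3)) H +
        ENNReal.ofReal (a ^ (2 * ρ)) * cknD a (0 : ℝ × EuclideanSpace ℝ (Fin 3)) p ≤ (c : ℝ≥0∞))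
    {V : EuclideanSpace ℝ (Fin 3) → EuclideanSpace ℝ (Fin 3)} {P : EuclideanSpace ℝ (Fin 3) → ℝ}
    (hu : ∀ τ : ℝ, τ < T₁ → u τ = fun x => selfSimilarCollapse (1 / (2 + ρ)) T V τ (x - x₀))
    (hp : ∀ τ : ℝ, τ < T₁ → p τ = fun x => selfSimilarCollapsePressure (1 / (2 + ρ)) T P τ (x - x₀))
    {a : ℝ} (ha : 0 < a) :
    ∃ K L₀ : ℝ, 0 ≤ K ∧ ∀ R : ℝ, L₀ ≤ R →
      volume ({y : EuclideanSpace ℝ (Fin 3) | a * ‖y‖ ≤ ‖V y‖} ∩ {y | R ≤ ‖y‖}) ≤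
        ENNReal.ofReal (K * R ^ (-3 - 3 * ρ)) := by
  have hA' : ∀ a : ℝ, 0 < a → ENNReal.ofReal (a ^ (2 * ρ)) *
      cknA a (0 : ℝ × EuclideanSpace ℝ (Fin 3)) u ≤ (c : ℝ≥0∞) :=
    fun a ha => le_trans (le_trans le_self_add le_self_add) (hgauge a ha)
  have hE' : ∀ a : ℝ, 0 < a → ENNReal.ofReal (a ^ ρ) *
      cknE a (0 : ℝ × EuclideanSpace ℝ (Fin 3)) H ≤ (c : ℝ≥0∞) :=
    fun a ha => le_trans (le_trans le_add_self le_self_add) (hgauge a ha)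
  have hD' : ∀ a : ℝ, 0 < a → ENNReal.ofReal (a ^ (2 * ρ)) *
      cknD a (0 : ℝ × EuclideanSpace ℝ (Fin 3)) p ≤ (c : ℝ≥0∞) :=
    fun a ha => le_trans le_add_self (hgauge a ha)
  obtain ⟨G, hVm, -, -, hVG, -, ⟨CA, hCA, hA⟩, ⟨CE, hCE, hE⟩, -⟩ :=
    Past.profileData_of_past hρ hρh hT₁ hTT₁ x₀ hsw.distributional hH hA' hE' hD' hu hp
  set L₀ : ℝ := max (2 - T₁) 1 with hL₀
  have hL₀1 : 1 ≤ L₀ := le_max_right _ _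
  have hAr : ∀ L : ℝ, L₀ ≤ L → ∫⁻ y in ball (0 : EuclideanSpace ℝ (Fin 3)) L, ‖V y‖ₑ ^ 2 ≤
      ENNReal.ofReal (CA.toReal * L ^ (1 - 2 * ρ)) := fun L hL => by
    rw [ENNReal.ofReal_mul ENNReal.toReal_nonneg, ENNReal.ofReal_toReal hCA]
    exact hA L (le_trans (le_max_left _ _) hL)
  have hEr : ∀ L : ℝ, L₀ ≤ L → ∫⁻ y in ball (0 : EuclideanSpace ℝ (Fin 3)) L, ENNReal.ofReal (frobeniusNormSq (G y)) ≤
      ENNReal.ofReal (CE.toReal * L ^ (1 - ρ)) := fun L hL => by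
    rw [ENNReal.ofReal_mul ENNReal.toReal_nonneg, ENNReal.ofReal_toReal hCE]
    exact hE L (le_trans (le_max_left _ _) hL)
  obtain ⟨K, hK0, hK⟩ := volume_fastSet_inter_far_le (ρ := ρ) (by linarith) hVm hVG ENNReal.toReal_nonneg
    ENNReal.toReal_nonneg hL₀1 hAr hEr ha
  exact ⟨K, L₀, hK0, hK⟩

end WeakThin

end Summit.NavierStokesRegularity.NavierStokesRegularity.Theorems.PowerGaugeEulerLiouville
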